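import Mathlib
import HarnessLib
import Summits.Ventures.LatticeQCDFlow.Exactness.LatticeBoundedDifferences

/-!
# Bounded differences ⇒ sub-Gaussian ⇒ tails: McDiarmid's inequality in tail form on a finite product of compact probability spaces, `π{±(G − ∫G) ≥ r} ≤ exp(−2r²/ΣD_k²)`

HONEST FRAMING: exact (Metropolis-corrected) sampling algorithms for lattice gauge theory;
figures of merit are autocorrelation/cost numbers at stated couplings and volumes; no
continuum-physics claim.

Venture `LatticeQCDFlow` (cell pub-lqcd), topic `Exactness`; FANOUT row 7 (`s0-cpn-null`).  NEW
WORK of the cell over this leg's `Exactness/LatticeBoundedDifferences.lean` (McDiarmid's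
exponential-moment bound `∫ e^{t(G − ∫G)} dπ ≤ exp(t²ΣD_k²/8)` for continuous bounded-difference
functionals), packaged through Mathlib's `ProbabilityTheory.HasSubgaussianMGF` and its Chernoff
bound `measure_ge_le`; nothing is cited as a fact.  Printed counterpart, NAMED ONLY: C. McDiarmid,
*On the method of bounded differences* (1989), Lemma (1.2): `P(|f − Ef| ≥ t) ≤ 2exp(−2t²/Σc_k²)`.
The lattice instance (the effective action of the exact leading-order trivializing flow) is the
sequel `Exactness/SphereLOFlowEffectiveActionTails.lean`.

## Content (`π = ⊗_ι μ`, `X` compact metric, `μ` Borel probability, `G` continuous with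
## `G(ω[k←v]) − G(ω[k←v']) ≤ D_k`)

* **`hasSubgaussianMGF_of_bddDiff`** — `HasSubgaussianMGF (G − ∫G dπ) (ΣD_k²/4) π`.
* **`measureReal_bddDiff_ge_le`** — `π{G − ∫G ≥ r} ≤ exp(−2r²/ΣD_k²)` (`r ≥ 0`, `ΣD_k² > 0`).
* **`measureReal_bddDiff_le_le`** — `π{G − ∫G ≤ −r} ≤ exp(−2r²/ΣD_k²)`.

NOT CLAIMED: lower tail-probability bounds; non-continuous functionals; infinite products.
-/

noncomputable section

namespace Summit.Ventures.LatticeQCDFlow.Exactness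

open MeasureTheory Function ProbabilityTheory Set
open scoped ENNReal NNReal

/-! ## §1 Bounded differences ⇒ sub-Gaussian ⇒ tails -/

section Generic

variable {ι : Type*} [Fintype ι] [DecidableEq ι]
variable {X : Type*} [MeasurableSpace X] [MetricSpace X] [CompactSpace X] [BorelSpace X]
variable (μ : Measure X) [IsProbabilityMeasure μ]

/-- **Bounded differences ⇒ sub-Gaussian**: `G − ∫G dπ` has a sub-Gaussian moment generating
function with parameter `ΣD_k²/4` (McDiarmid's exponential-moment bound, repackaged). -/
theorem hasSubgaussianMGF_of_bddDiff {G : (ι → X) → ℝ} (hG : Continuous G) {D : ι → ℝ}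
    (hD : ∀ ω k v v', G (update ω k v) - G (update ω k v') ≤ D k) :
    HasSubgaussianMGF (fun ω => G ω - ∫ ω', G ω' ∂Measure.pi (fun _ : ι => μ))
      ((∑ k, D k ^ 2) / 4).toNNReal (Measure.pi (fun _ : ι => μ)) := by
  have hnn : 0 ≤ (∑ k, D k ^ 2) / 4 := by positivity
  refine ⟨fun t => ?_, fun t => ?_⟩
  · exact integrable_pi_of_continuous μ
      (Real.continuous_exp.comp (continuous_const.mul (hG.sub continuous_const)))
  · have h := mcdiarmid_integral_exp_le μ hG hD t
    rw [Real.coe_toNNReal _ hnn]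
    simp only [mgf]
    refine h.trans (le_of_eq ?_)
    congr 1
    ring

/-- **McDIARMID'S INEQUALITY, UPPER TAIL**: `π{G − ∫G ≥ r} ≤ exp(−2r²/ΣD_k²)` for `r ≥ 0`
(when `ΣD_k² > 0`). -/
theorem measureReal_bddDiff_ge_le {G : (ι → X) → ℝ} (hG : Continuous G) {D : ι → ℝ}
    (hD : ∀ ω k v v', G (update ω k v) - G (update ω k v') ≤ D k) (hpos : 0 < ∑ k, D k ^ 2)
    {r : ℝ} (hr : 0 ≤ r) :
    (Measure.pi (fun _ : ι => μ)).real
        {ω | r ≤ G ω - ∫ ω', G ω' ∂Measure.pi (fun _ : ι => μ)} ≤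
      Real.exp (-(2 * r ^ 2 / ∑ k, D k ^ 2)) := by
  have hnn : 0 ≤ (∑ k, D k ^ 2) / 4 := by positivity
  have h := (hasSubgaussianMGF_of_bddDiff μ hG hD).measure_ge_le hr
  rw [Real.coe_toNNReal _ hnn] at h
  refine h.trans (le_of_eq ?_)
  congr 1
  field_simp
  ring

/-- **McDIARMID'S INEQUALITY, LOWER TAIL**: `π{G − ∫G ≤ −r} ≤ exp(−2r²/ΣD_k²)` for `r ≥ 0`
(apply the upper tail to `−G`, whose differences are bounded by the same `D_k`). -/
theorem measureReal_bddDiff_le_le {G : (ι → X) → ℝ} (hG : Continuous G) {D : ι → ℝ}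
    (hD : ∀ ω k v v', G (update ω k v) - G (update ω k v') ≤ D k) (hpos : 0 < ∑ k, D k ^ 2)
    {r : ℝ} (hr : 0 ≤ r) :
    (Measure.pi (fun _ : ι => μ)).real
        {ω | G ω - ∫ ω', G ω' ∂Measure.pi (fun _ : ι => μ) ≤ -r} ≤
      Real.exp (-(2 * r ^ 2 / ∑ k, D k ^ 2)) := by
  have hD' : ∀ ω k v v', (-G (update ω k v)) - (-G (update ω k v')) ≤ D k := by
    intro ω k v v'
    have h := hD ω k v' v
    linarith
  have h := measureReal_bddDiff_ge_le μ (G := fun ω => -G ω) hG.neg hD' hpos hr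
  have hI : ∫ ω', -G ω' ∂Measure.pi (fun _ : ι => μ) = -∫ ω', G ω' ∂Measure.pi (fun _ : ι => μ) :=
    integral_neg _
  rw [hI] at h
  refine le_trans (le_of_eq ?_) h
  congr 1
  ext ω
  simp only [mem_setOf_eq]
  constructor <;> intro hω <;> linarith

end Generic

end Summit.Ventures.LatticeQCDFlow.Exactness

end
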